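import Summits.Parity.GeneralizedHardyLittlewood.Theorems.LeeYangFibresRelativeDimOneNecessityDefs
import Literature.NumberTheory.Sieve.RoughNumbersInProgressions
import HarnessLib

/-!
# Brun–Titchmarsh sup bound for `ψ(x; q, a)` below a power level
(crux stmt-Parity-14113 `LeeYangFibres.RelativeDimOne`, line gallagher-backwards-split, aux for stub
`stub_classMoments`)

For every `θ < 1` there are `C = C(θ)` and `x₀ = x₀(θ)` with
`ψ(x; q, a) = ∑_{n ≤ x, n % q = a} Λ(n) ≤ C x / φ(q)` for all `x ≥ x₀`, all `1 ≤ q ≤ x^θ` and ALL residues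
`a` (`classPsi_le_of_level`). This is the weak Brun–Titchmarsh bound that the moving class moments
(`MovingClassMoments`) need as a sup bound on the `Λ`-mass of a residue class in a window of length
`≍ N` at height `≍ N`.

Proof sketch. With `z = x^γ`, `γ = (1-θ)/20`:
* coprime classes: the `n ≤ x` of the class with `Λ(n) ≠ 0` are prime powers `p^k`; those with `p ≥ z`
  are free of prime factors `< z`, so they are counted by the tree's sifted-progression bound
  `card_roughAP_le` (beta-sieve, Hooley's Lemma 8 shape): `≤ K (x/(φ(q) log z) + z^{10})`, each weighted
  by `Λ(n) ≤ log x`; those with `p < z` contribute `≤ π(z) · log₂ x · log x` (prime powers with a bounded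
  prime, `sum_vonMangoldt_le_of_minFac_mem`);
* non-coprime classes: every prime power in the class is a power of a prime factor of `q`, so the
  class carries `≤ ω(q) log₂ x log x ≤ 4 log³ x`;
* all junk terms are `≤ x^{1-θ} ≤ x/φ(q)` for `x ≥ x₀(θ)`.
-/

noncomputable section

open scoped BigOperators Classical Topology ArithmeticFunction.vonMangoldt
open Finset Filter Literature.NumberTheory.Sieve
open Summit.Parity.GeneralizedHardyLittlewood.Cruxes.RelativeDimOne.GallagherBackwards (classPsi)

namespace Summit.Parity.GeneralizedHardyLittlewood.Cruxes.RelativeDimOne.GallagherBackwardsSplit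

namespace BrunTitchmarshAP

/-! ### Prime powers with a prescribed prime -/

/-- Prime powers `n ≤ x` whose prime lies in a finite set `P` carry `Λ`-mass `≤ #P · log₂ x · log x`:
each such `n = p^k` has `k ≤ log₂ x` and `Λ(n) ≤ log x`. -/
theorem sum_vonMangoldt_le_of_minFac_mem (x : ℕ) (P T : Finset ℕ) (hT : T ⊆ Icc 1 x)
    (hP : ∀ n ∈ T, Λ n ≠ 0 → n.minFac ∈ P) :
    ∑ n ∈ T, Λ n ≤ (#P : ℝ) * Nat.log 2 x * Real.log x := by
  rw [← Finset.sum_filter_ne_zero T]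
  set T' := T.filter (fun n => Λ n ≠ 0) with hT'
  have hsub : T' ⊆ (P ×ˢ Icc 1 (Nat.log 2 x)).image (fun pk : ℕ × ℕ => pk.1 ^ pk.2) := by
    intro n hn
    rw [hT', mem_filter] at hn
    obtain ⟨hnT, hΛ⟩ := hn
    have hpp : IsPrimePow n := ArithmeticFunction.vonMangoldt_ne_zero_iff.1 hΛ
    obtain ⟨p, k, hp, hk, rfl⟩ := (isPrimePow_nat_iff n).1 hpp
    rw [mem_image]
    refine ⟨(p, k), ?_, rfl⟩
    rw [mem_product, mem_Icc]
    have hmin : (p ^ k).minFac = p := hp.pow_minFac hk.ne'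
    have hpP : p ∈ P := by
      have := hP _ hnT hΛ
      rwa [hmin] at this
    refine ⟨hpP, hk, ?_⟩
    have hx : p ^ k ≤ x := (mem_Icc.1 (hT hnT)).2
    exact Nat.le_log_of_pow_le one_lt_two ((Nat.pow_le_pow_left hp.two_le k).trans hx)
  have hcard : #T' ≤ #P * Nat.log 2 x :=
    calc #T' ≤ #((P ×ˢ Icc 1 (Nat.log 2 x)).image (fun pk : ℕ × ℕ => pk.1 ^ pk.2)) :=
          card_le_card hsub
      _ ≤ #(P ×ˢ Icc 1 (Nat.log 2 x)) := card_image_le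
      _ = #P * Nat.log 2 x := by rw [card_product, Nat.card_Icc, Nat.add_sub_cancel]
  have hlogx : 0 ≤ Real.log x := Real.log_natCast_nonneg x
  calc ∑ n ∈ T', Λ n ≤ ∑ n ∈ T', Real.log x := by
        refine sum_le_sum fun n hn => ?_
        have hn' := mem_Icc.1 (hT (mem_filter.1 hn).1)
        exact ArithmeticFunction.vonMangoldt_le_log.trans
          (Real.log_le_log (by exact_mod_cast hn'.1) (by exact_mod_cast hn'.2))
    _ = #T' * Real.log x := by rw [sum_const, nsmul_eq_mul]
    _ ≤ ((#P * Nat.log 2 x : ℕ) : ℝ) * Real.log x := by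
        refine mul_le_mul_of_nonneg_right ?_ hlogx
        exact_mod_cast hcard
    _ = (#P : ℝ) * Nat.log 2 x * Real.log x := by push_cast; ring

/-- `ω(q) ≤ log₂ q`: `2^{ω(q)} ≤ ∏_{p ∣ q} p ≤ q`. -/
theorem card_primeFactors_le_log {q : ℕ} (hq : 0 < q) : #q.primeFactors ≤ Nat.log 2 q := by
  apply Nat.le_log_of_pow_le one_lt_two
  calc 2 ^ #q.primeFactors ≤ ∏ p ∈ q.primeFactors, p :=
        Finset.pow_card_le_prod q.primeFactors (fun p => p) 2
          (fun p hp => (Nat.prime_of_mem_primeFactors hp).two_le)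
    _ ≤ q := Nat.le_of_dvd hq (Nat.prod_primeFactors_dvd q)

/-- `log₂ x · log x ≤ 2 log² x` (`Nat.log` against the real logarithm; `log 2 > 1/2`). -/
theorem natLog_two_mul_log_le (x : ℕ) : (Nat.log 2 x : ℝ) * Real.log x ≤ 2 * Real.log x ^ 2 := by
  rcases Nat.eq_zero_or_pos x with rfl | hx
  · simp
  · have h1 : ((2 ^ Nat.log 2 x : ℕ) : ℝ) ≤ x := by exact_mod_cast Nat.pow_log_le_self 2 hx.ne'
    have h2 : Real.log ((2 ^ Nat.log 2 x : ℕ) : ℝ) ≤ Real.log x :=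
      Real.log_le_log (by positivity) h1
    rw [Nat.cast_pow, Nat.cast_ofNat, Real.log_pow] at h2
    have hlog2 : (0.6931471803 : ℝ) < Real.log 2 := Real.log_two_gt_d9
    have h0 : (0 : ℝ) ≤ Nat.log 2 x := Nat.cast_nonneg _
    have hl : (0 : ℝ) ≤ Real.log x := Real.log_natCast_nonneg x
    nlinarith [mul_le_mul_of_nonneg_right h2 hl]

/-- `#(primesBelow k) ≤ k`. -/
theorem card_primesBelow_le (k : ℕ) : #k.primesBelow ≤ k := by
  calc #k.primesBelow ≤ #(range k) :=
        card_le_card fun p hp => mem_range.2 (Nat.mem_primesBelow.1 hp).1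
    _ = k := card_range k

/-- A prime power `n = p^k` (`Λ(n) ≠ 0`) not coprime to `m` has `p ∣ m`, `p = minFac n`. -/
theorem minFac_dvd_of_not_coprime {n m : ℕ} (hΛ : Λ n ≠ 0) (h : ¬ n.Coprime m) :
    n.minFac.Prime ∧ n.minFac ∣ m := by
  have hpp : IsPrimePow n := ArithmeticFunction.vonMangoldt_ne_zero_iff.1 hΛ
  obtain ⟨p, k, hp, hk, rfl⟩ := (isPrimePow_nat_iff n).1 hpp
  rw [hp.pow_minFac hk.ne']
  obtain ⟨ℓ, hℓ, hℓn, hℓm⟩ := Nat.Prime.not_coprime_iff_dvd.1 h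
  have hℓp : ℓ = p := (Nat.prime_dvd_prime_iff_eq hℓ hp).1 (hℓ.dvd_of_dvd_pow hℓn)
  exact ⟨hp, hℓp ▸ hℓm⟩

/-! ### The class sums -/

/-- Non-coprime classes: `ψ(x; q, a) ≤ 4 log³ x` when `gcd(a, q) > 1` and `1 ≤ q ≤ x`
(only powers of the `ω(q) ≤ log₂ q` primes dividing `q` occur). -/
theorem classPsi_le_of_not_coprime {x q a : ℕ} (hq : 0 < q) (hqx : q ≤ x) (ha : ¬ a.Coprime q) :
    classPsi x q a ≤ 4 * Real.log x ^ 3 := by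
  have hx : 0 < x := lt_of_lt_of_le hq hqx
  have hmem : ∀ n ∈ (Icc 1 x).filter (fun n => n % q = a), Λ n ≠ 0 → n.minFac ∈ q.primeFactors := by
    intro n hn hΛ
    rw [mem_filter] at hn
    have hnq : ¬ n.Coprime q := by
      intro hcop
      apply ha
      have : Nat.gcd n q = Nat.gcd a q := by
        rw [Nat.gcd_comm n q, Nat.gcd_rec q n, hn.2]
      rw [Nat.Coprime, ← this]
      exact hcop
    obtain ⟨hp, hdvd⟩ := minFac_dvd_of_not_coprime hΛ hnq
    exact Nat.mem_primeFactors.2 ⟨hp, hdvd, hq.ne'⟩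
  have h1 := sum_vonMangoldt_le_of_minFac_mem x q.primeFactors _ (filter_subset _ _) hmem
  have hlogx : 0 ≤ Real.log x := Real.log_natCast_nonneg x
  have hω : (#q.primeFactors : ℝ) ≤ Nat.log 2 x := by
    exact_mod_cast (card_primeFactors_le_log hq).trans (Nat.log_mono_right hqx)
  have hl2 : (Nat.log 2 x : ℝ) * Real.log x ≤ 2 * Real.log x ^ 2 := natLog_two_mul_log_le x
  have h0 : (0 : ℝ) ≤ Nat.log 2 x := Nat.cast_nonneg _
  calc classPsi x q a = ∑ n ∈ (Icc 1 x).filter (fun n => n % q = a), Λ n := rfl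
    _ ≤ (#q.primeFactors : ℝ) * Nat.log 2 x * Real.log x := h1
    _ ≤ (Nat.log 2 x : ℝ) * Nat.log 2 x * Real.log x := by
        apply mul_le_mul_of_nonneg_right _ hlogx
        exact mul_le_mul_of_nonneg_right hω h0
    _ = (Nat.log 2 x : ℝ) * (Nat.log 2 x * Real.log x) := by ring
    _ ≤ (Nat.log 2 x : ℝ) * (2 * Real.log x ^ 2) := mul_le_mul_of_nonneg_left hl2 h0
    _ = 2 * Real.log x * (Nat.log 2 x * Real.log x) := by ring
    _ ≤ 2 * Real.log x * (2 * Real.log x ^ 2) :=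
        mul_le_mul_of_nonneg_left hl2 (by positivity)
    _ = 4 * Real.log x ^ 3 := by ring

/-- Coprime classes, sieve step: for real `z ≥ 2` and `gcd(a, q) = 1`,
`ψ(x; q, a) ≤ log x · K (x/(φ(q) log z) + z^{10}) + (z + 1) · log₂ x · log x`, `K` the constant of
`card_roughAP_le`. -/
theorem classPsi_le_of_coprime {K : ℝ}
    (hK : ∀ z : ℝ, 2 ≤ z → ∀ q : ℕ, 0 < q → ∀ s : ℕ, s.Coprime q → ∀ y : ℝ, 0 ≤ y →
      (#((Ioc 0 ⌊y⌋₊).filter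
          (fun n : ℕ => n ≡ s [MOD q] ∧ n.Coprime (primesProdBelow z))) : ℝ) ≤
        K * (y / ((Nat.totient q : ℝ) * Real.log z) + z ^ (10 : ℕ)))
    {x q a : ℕ} (hq : 0 < q) (ha : a.Coprime q) {z : ℝ} (hz : 2 ≤ z) :
    classPsi x q a ≤ Real.log x * (K * ((x : ℝ) / ((Nat.totient q : ℝ) * Real.log z) + z ^ (10 : ℕ)))
      + (z + 1) * Nat.log 2 x * Real.log x := by
  set S := (Icc 1 x).filter (fun n => n % q = a) with hS
  have hlogx : 0 ≤ Real.log x := Real.log_natCast_nonneg x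
  have hsplit := Finset.sum_filter_add_sum_filter_not S
    (fun n : ℕ => n.Coprime (primesProdBelow z)) (fun n => (Λ n : ℝ))
  -- rough part
  have hrough : ∑ n ∈ S.filter (fun n : ℕ => n.Coprime (primesProdBelow z)), Λ n ≤
      Real.log x * (K * ((x : ℝ) / ((Nat.totient q : ℝ) * Real.log z) + z ^ (10 : ℕ))) := by
    have hsub : S.filter (fun n : ℕ => n.Coprime (primesProdBelow z)) ⊆
        (Ioc 0 ⌊((x : ℕ) : ℝ)⌋₊).filter
          (fun n : ℕ => n ≡ a [MOD q] ∧ n.Coprime (primesProdBelow z)) := by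
      intro n hn
      rw [mem_filter, hS, mem_filter, mem_Icc] at hn
      rw [mem_filter, mem_Ioc, Nat.floor_natCast]
      refine ⟨⟨hn.1.1.1, hn.1.1.2⟩, ?_, hn.2⟩
      have hmod : n % q = a := hn.1.2
      have ha' : a < q := hmod ▸ Nat.mod_lt n hq
      show n % q = a % q
      rw [Nat.mod_eq_of_lt ha', hmod]
    have hcard := (Nat.cast_le (α := ℝ)).2 (card_le_card hsub)
    have hKb := hK z hz q hq a ha (x : ℝ) (Nat.cast_nonneg x)
    calc ∑ n ∈ S.filter (fun n : ℕ => n.Coprime (primesProdBelow z)), Λ n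
        ≤ ∑ n ∈ S.filter (fun n : ℕ => n.Coprime (primesProdBelow z)), Real.log x := by
          refine sum_le_sum fun n hn => ?_
          have hn' := mem_Icc.1 (mem_filter.1 (mem_filter.1 hn).1).1
          exact ArithmeticFunction.vonMangoldt_le_log.trans
            (Real.log_le_log (by exact_mod_cast hn'.1) (by exact_mod_cast hn'.2))
      _ = #(S.filter (fun n : ℕ => n.Coprime (primesProdBelow z))) * Real.log x := by
          rw [sum_const, nsmul_eq_mul]
      _ ≤ (K * ((x : ℝ) / ((Nat.totient q : ℝ) * Real.log z) + z ^ (10 : ℕ))) * Real.log x :=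
          mul_le_mul_of_nonneg_right (hcard.trans hKb) hlogx
      _ = _ := by ring
  -- smooth part: prime powers `p^k` with `p < z`
  have hsmooth : ∑ n ∈ S.filter (fun n : ℕ => ¬ n.Coprime (primesProdBelow z)), Λ n ≤
      (z + 1) * Nat.log 2 x * Real.log x := by
    have hmem : ∀ n ∈ S.filter (fun n : ℕ => ¬ n.Coprime (primesProdBelow z)), Λ n ≠ 0 →
        n.minFac ∈ (⌈z⌉₊).primesBelow := by
      intro n hn hΛ
      rw [mem_filter] at hn
      obtain ⟨hp, hdvd⟩ := minFac_dvd_of_not_coprime hΛ hn.2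
      rw [Nat.mem_primesBelow]
      exact ⟨Nat.lt_ceil.2 ((dvd_primesProdBelow_iff hp z).1 hdvd), hp⟩
    have hsubI : S.filter (fun n : ℕ => ¬ n.Coprime (primesProdBelow z)) ⊆ Icc 1 x :=
      (filter_subset _ _).trans (filter_subset _ _)
    have h1 := sum_vonMangoldt_le_of_minFac_mem x _ _ hsubI hmem
    have hz0 : 0 ≤ z := by linarith
    have hcard : (#(⌈z⌉₊).primesBelow : ℝ) ≤ z + 1 := by
      calc (#(⌈z⌉₊).primesBelow : ℝ) ≤ ⌈z⌉₊ := by exact_mod_cast card_primesBelow_le _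
        _ ≤ z + 1 := (Nat.ceil_lt_add_one hz0).le
    have h0 : (0 : ℝ) ≤ Nat.log 2 x := Nat.cast_nonneg _
    calc _ ≤ (#(⌈z⌉₊).primesBelow : ℝ) * Nat.log 2 x * Real.log x := h1
      _ ≤ (z + 1) * Nat.log 2 x * Real.log x := by
          apply mul_le_mul_of_nonneg_right _ hlogx
          exact mul_le_mul_of_nonneg_right hcard h0
  calc classPsi x q a = ∑ n ∈ S, Λ n := rfl
    _ = _ := hsplit.symm
    _ ≤ _ := add_le_add hrough hsmooth

/-- Eventual statements along the reals restrict to eventual statements along the naturals. -/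
theorem exists_nat_of_eventually {P : ℝ → Prop} (h : ∀ᶠ x : ℝ in atTop, P x) :
    ∃ x₀ : ℕ, ∀ x : ℕ, x₀ ≤ x → P x :=
  eventually_atTop.1 (tendsto_natCast_atTop_atTop.eventually h)

/-- The junk terms are eventually `≤ x^{1-θ}`: with `γ = (1-θ)/20`, eventually in real `x`,
`2 ≤ x^γ`, `K (x^γ)^{10} log x ≤ x^{1-θ}`, `(x^γ + 1)(2 log x) log x ≤ x^{1-θ}`, `4 log³ x ≤ x^{1-θ}`. -/
theorem eventually_junk_le {θ : ℝ} (hθ : θ < 1) (K : ℝ) (hK : 0 < K) :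
    ∀ᶠ x : ℝ in atTop, 2 ≤ x ^ ((1 - θ) / 20) ∧
      K * (x ^ ((1 - θ) / 20)) ^ (10 : ℕ) * Real.log x ≤ x ^ (1 - θ) ∧
      (x ^ ((1 - θ) / 20) + 1) * (2 * Real.log x) * Real.log x ≤ x ^ (1 - θ) ∧
      4 * Real.log x ^ 3 ≤ x ^ (1 - θ) := by
  set γ : ℝ := (1 - θ) / 20 with hγ
  have hγ0 : 0 < γ := by rw [hγ]; linarith
  have e1 : ∀ᶠ x : ℝ in atTop, 2 ≤ x ^ γ := (tendsto_rpow_atTop hγ0).eventually_ge_atTop 2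
  have e2 : ∀ᶠ x : ℝ in atTop, K * (x ^ γ) ^ (10 : ℕ) * Real.log x ≤ x ^ (1 - θ) := by
    have h := (isLittleO_log_rpow_atTop (by positivity : (0 : ℝ) < 10 * γ)).def
      (by positivity : (0 : ℝ) < 1 / K)
    filter_upwards [h, eventually_ge_atTop (1 : ℝ)] with x hx hx1
    have hx0 : 0 < x := by linarith
    rw [Real.norm_of_nonneg (Real.log_nonneg hx1),
      Real.norm_of_nonneg (Real.rpow_nonneg hx0.le _)] at hx
    have hpow : (x ^ γ) ^ (10 : ℕ) = x ^ (10 * γ) := by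
      rw [← Real.rpow_natCast, ← Real.rpow_mul hx0.le, mul_comm]
      norm_num
    have hsplit : x ^ (1 - θ) = x ^ (10 * γ) * x ^ (10 * γ) := by
      rw [← Real.rpow_add hx0]
      congr 1
      rw [hγ]; ring
    rw [hpow, hsplit]
    have hpos : 0 ≤ x ^ (10 * γ) := Real.rpow_nonneg hx0.le _
    calc K * x ^ (10 * γ) * Real.log x ≤ K * x ^ (10 * γ) * (1 / K * x ^ (10 * γ)) := by
          apply mul_le_mul_of_nonneg_left hx; positivity
      _ = x ^ (10 * γ) * x ^ (10 * γ) := by field_simp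
  have e3 : ∀ᶠ x : ℝ in atTop, (x ^ γ + 1) * (2 * Real.log x) * Real.log x ≤ x ^ (1 - θ) := by
    have h := (isLittleO_log_rpow_rpow_atTop ((2 : ℕ) : ℝ) (by positivity : (0 : ℝ) < 19 * γ)).def
      (by norm_num : (0 : ℝ) < 1 / 4)
    filter_upwards [h, eventually_ge_atTop (1 : ℝ)] with x hx hx1
    have hx0 : 0 < x := by linarith
    have hl : 0 ≤ Real.log x := Real.log_nonneg hx1
    rw [Real.rpow_natCast, Real.norm_of_nonneg (pow_nonneg hl 2),
      Real.norm_of_nonneg (Real.rpow_nonneg hx0.le _)] at hx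
    have hone : 1 ≤ x ^ γ := Real.one_le_rpow hx1 hγ0.le
    have hsplit : x ^ (1 - θ) = x ^ γ * x ^ (19 * γ) := by
      rw [← Real.rpow_add hx0]
      congr 1
      rw [hγ]; ring
    rw [hsplit]
    have hpos : 0 ≤ x ^ (19 * γ) := Real.rpow_nonneg hx0.le _
    have hlog0 : 0 ≤ Real.log x ^ 2 := by positivity
    calc (x ^ γ + 1) * (2 * Real.log x) * Real.log x = 2 * (x ^ γ + 1) * Real.log x ^ 2 := by ring
      _ ≤ 2 * (x ^ γ + x ^ γ) * (1 / 4 * x ^ (19 * γ)) := by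
          apply mul_le_mul _ hx hlog0 (by positivity)
          linarith
      _ = x ^ γ * x ^ (19 * γ) := by ring
  have e4 : ∀ᶠ x : ℝ in atTop, 4 * Real.log x ^ 3 ≤ x ^ (1 - θ) := by
    have h := (isLittleO_log_rpow_rpow_atTop ((3 : ℕ) : ℝ) (by linarith : (0 : ℝ) < 1 - θ)).def
      (by norm_num : (0 : ℝ) < 1 / 4)
    filter_upwards [h, eventually_ge_atTop (1 : ℝ)] with x hx hx1
    have hx0 : 0 < x := by linarith
    have hl : 0 ≤ Real.log x := Real.log_nonneg hx1
    rw [Real.rpow_natCast, Real.norm_of_nonneg (pow_nonneg hl 3),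
      Real.norm_of_nonneg (Real.rpow_nonneg hx0.le _)] at hx
    linarith
  exact (e1.and e2).and (e3.and e4) |>.mono fun x hx => ⟨hx.1.1, hx.1.2, hx.2.1, hx.2.2⟩

end BrunTitchmarshAP

open BrunTitchmarshAP in
/-- **Brun–Titchmarsh sup bound for residue classes below a power level.** For every `θ < 1` there
are `C > 0` and `x₀` with `ψ(x; q, a) ≤ C x / φ(q)` for all naturals `x ≥ x₀`, all moduli
`1 ≤ q ≤ x^θ` and all residues `a` (coprime or not). Registered auxiliary of stub `stub_classMoments`. -/
theorem classPsi_le_of_level : ∀ θ : ℝ, θ < 1 → ∃ C : ℝ, 0 < C ∧ ∃ x₀ : ℕ, ∀ x : ℕ, x₀ ≤ x → ∀ q : ℕ, 1 ≤ q → (q : ℝ) ≤ (x : ℝ) ^ θ → ∀ a : ℕ, classPsi x q a ≤ C * x / Nat.totient q := by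
  intro θ hθ
  obtain ⟨K, hK, hKb⟩ := card_roughAP_le
  set γ : ℝ := (1 - θ) / 20 with hγ
  have hγ0 : 0 < γ := by rw [hγ]; linarith
  refine ⟨K / γ + 2, by positivity, ?_⟩
  obtain ⟨x₀, hx₀⟩ := exists_nat_of_eventually
    ((eventually_junk_le hθ K hK).and (eventually_ge_atTop (2 : ℝ)))
  refine ⟨x₀, fun x hx q hq hqx a => ?_⟩
  obtain ⟨⟨h1, h2, h3, h4⟩, hx2⟩ := hx₀ x hx
  have hx0 : (0 : ℝ) < x := by linarith
  have hx1 : (1 : ℝ) ≤ x := by linarith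
  have hq0 : 0 < q := hq
  have hφ0 : (0 : ℝ) < Nat.totient q := by exact_mod_cast Nat.totient_pos.2 hq0
  have hφq : (Nat.totient q : ℝ) ≤ q := by exact_mod_cast Nat.totient_le q
  have hxφ : (0 : ℝ) ≤ x / Nat.totient q := by positivity
  -- `x^{1-θ} ≤ x / φ(q)`
  have hlevel : (x : ℝ) ^ (1 - θ) ≤ x / Nat.totient q := by
    rw [Real.rpow_sub hx0, Real.rpow_one]
    exact div_le_div_of_nonneg_left hx0.le hφ0 (hφq.trans hqx)
  -- `q ≤ x`
  have hqx' : (q : ℝ) ≤ x := by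
    refine hqx.trans ?_
    have := Real.rpow_le_rpow_of_exponent_le hx1 hθ.le
    rwa [Real.rpow_one] at this
  have hC1 : (x : ℝ) / Nat.totient q ≤ (K / γ + 2) * x / Nat.totient q := by
    rw [mul_div_assoc]
    have : (1 : ℝ) ≤ K / γ + 2 := by
      have : 0 ≤ K / γ := by positivity
      linarith
    nlinarith
  by_cases hcop : a.Coprime q
  · have hb := classPsi_le_of_coprime hKb hq0 hcop h1 (x := x)
    have hlogz : Real.log ((x : ℝ) ^ γ) = γ * Real.log x := Real.log_rpow hx0 γ
    rw [hlogz] at hb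
    have hlogx0 : 0 < Real.log x := Real.log_pos (by linarith)
    have hrew : Real.log x * (K * ((x : ℝ) / ((Nat.totient q : ℝ) * (γ * Real.log x)) +
        ((x : ℝ) ^ γ) ^ (10 : ℕ))) =
        K / γ * (x / Nat.totient q) + K * ((x : ℝ) ^ γ) ^ (10 : ℕ) * Real.log x := by
      field_simp
    have hl2 : (Nat.log 2 x : ℝ) * Real.log x ≤ 2 * Real.log x ^ 2 := natLog_two_mul_log_le x
    have hsm : ((x : ℝ) ^ γ + 1) * Nat.log 2 x * Real.log x ≤
        ((x : ℝ) ^ γ + 1) * (2 * Real.log x) * Real.log x := by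
      have hz0 : (0 : ℝ) ≤ (x : ℝ) ^ γ + 1 := by
        have : (0 : ℝ) ≤ (x : ℝ) ^ γ := Real.rpow_nonneg hx0.le _
        linarith
      calc ((x : ℝ) ^ γ + 1) * Nat.log 2 x * Real.log x
          = ((x : ℝ) ^ γ + 1) * (Nat.log 2 x * Real.log x) := by ring
        _ ≤ ((x : ℝ) ^ γ + 1) * (2 * Real.log x ^ 2) := mul_le_mul_of_nonneg_left hl2 hz0
        _ = ((x : ℝ) ^ γ + 1) * (2 * Real.log x) * Real.log x := by ring
    calc classPsi x q a ≤ _ := hb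
      _ = K / γ * (x / Nat.totient q) + K * ((x : ℝ) ^ γ) ^ (10 : ℕ) * Real.log x +
            ((x : ℝ) ^ γ + 1) * Nat.log 2 x * Real.log x := by rw [hrew]
      _ ≤ K / γ * (x / Nat.totient q) + (x : ℝ) ^ (1 - θ) + (x : ℝ) ^ (1 - θ) :=
          add_le_add (add_le_add le_rfl h2) (hsm.trans h3)
      _ ≤ K / γ * (x / Nat.totient q) + x / Nat.totient q + x / Nat.totient q := by linarith
      _ = (K / γ + 2) * x / Nat.totient q := by ring
  · have hb := classPsi_le_of_not_coprime hq0 (by exact_mod_cast hqx' : q ≤ x) hcop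
    calc classPsi x q a ≤ 4 * Real.log x ^ 3 := hb
      _ ≤ (x : ℝ) ^ (1 - θ) := h4
      _ ≤ x / Nat.totient q := hlevel
      _ ≤ (K / γ + 2) * x / Nat.totient q := hC1

end Summit.Parity.GeneralizedHardyLittlewood.Cruxes.RelativeDimOne.GallagherBackwardsSplit
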